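import Summits.CriticalPhenomena.SAWScalingLimit.Theorems.SAWLoopFugacityFlowIsingBoundaryRatioWindowRectPolygonRange
import HarnessLib

/-!
# The offset boundary polygon: coordinates of side and connector points near a lattice point
(line `fk-anchor-transfer`, crux `IsingBoundaryRatio`, stmt-CriticalPhenomena-10650; helper file of the stub
`windowRectPresentation_holds`)

Frame calculus for the points `framePt δ (x, k) a b = δx + a e_k + b e_{k+1}` of `…WindowRectGeomDefs.lean`:
rotation of the frame (`framePt_rot_one/two/three`), uniqueness of frame coordinates (`framePt_inj_iff`),
reversal of an arrow (`framePt_reverse`), and the two **localisation lemmas**: a point of the side of a dart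
`(v, K)` (`side_near`) or a connector point alongside an edge of `E` (`conn_near`) that lies within sup-distance
`< δ - η` of a lattice point `δx` is based at `x` itself (`v = x`, resp. the edge is an edge at `x`), with
explicit frame coordinates. Everything is elementary real arithmetic. [folklore]
-/

noncomputable section

open scoped Classical
open Set Literature.Probability.LatticeModels Literature.Probability.LatticeModels.DiscreteRect

namespace Summit.CriticalPhenomena.SAWScalingLimit.Theorems.IsingBoundaryRatio

namespace WindowRect

variable {δ η : ℝ} {E : Finset (Sym2 (Site 2))}

/-! ### Integer bookkeeping -/

/-- A real `a` with `|a| ≤ η` within `δ - η` of the multiple `δ n` forces `n = 0`. [folklore] -/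
theorem int_eq_zero_of_near (hδ : 0 < δ) {n : ℤ} {a : ℝ} (ha : |a| ≤ η) (h : |a - δ * n| < δ - η) : n = 0 := by
  by_contra hn
  have h1 : (1 : ℝ) ≤ |(n : ℝ)| := by exact_mod_cast Int.one_le_abs hn
  have h2 : δ ≤ |δ * n| := by rw [abs_mul, abs_of_pos hδ]; nlinarith
  have h3 : |δ * n| - |a| ≤ |a - δ * n| := by
    have := abs_sub_abs_le_abs_sub (δ * n) a
    rwa [abs_sub_comm] at this
  linarith

/-- A real `t ∈ [η, δ - η]` within `δ - η` of... with `|t - δ n| < δ - η` forces `n = 0` or `n = 1`. [folklore] -/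
theorem int_eq_zero_or_one_of_near (hδ : 0 < δ) (hη : 0 < η) {n : ℤ} {t : ℝ} (ht : t ∈ Icc η (δ - η))
    (h : |t - δ * n| < δ - η) : n = 0 ∨ n = 1 := by
  obtain ⟨h1, h2⟩ := abs_lt.1 h
  have hn2 : n < 2 := by
    by_contra hc
    push Not at hc
    have hc' : (2 : ℝ) ≤ n := by exact_mod_cast hc
    have : δ * 2 ≤ δ * n := mul_le_mul_of_nonneg_left hc' hδ.le
    linarith [ht.2]
  have hn0 : -1 < n := by
    by_contra hc
    push Not at hc
    have hc' : (n : ℝ) ≤ -1 := by exact_mod_cast hc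
    have : δ * n ≤ δ * (-1) := mul_le_mul_of_nonneg_left hc' hδ.le
    linarith [ht.1]
  omega

/-! ### Frame calculus -/

/-- The sum of squares of the coordinates of `dir k` is `1`, and the frame `(e_k, e_{k+1})` is
orthonormal: uniqueness of frame coordinates. [folklore] -/
theorem eq_of_frame_eq {k : Fin 4} {u w u' w' : ℝ}
    (h : meshPoint u (dir k) + meshPoint w (dir (k + 1)) = meshPoint u' (dir k) + meshPoint w' (dir (k + 1))) :
    u = u' ∧ w = w' := by
  have hre := congrArg Complex.re h
  have him := congrArg Complex.im h
  simp only [Complex.add_re, Complex.add_im, meshPoint_re, meshPoint_im, dir_succ_apply_zero,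
    dir_succ_apply_one, Int.cast_neg] at hre him
  rcases dir_apply_cases k with ⟨h0, h1⟩ | ⟨h0, h1⟩ | ⟨h0, h1⟩ | ⟨h0, h1⟩ <;>
    simp only [h0, h1, Int.cast_one, Int.cast_zero, Int.cast_neg] at hre him <;> constructor <;> linarith

/-- Uniqueness of frame coordinates at a fixed arrow. [folklore] -/
theorem framePt_inj_iff {x : Site 2} {k : Fin 4} {a b a' b' : ℝ} :
    framePt δ (x, k) a b = framePt δ (x, k) a' b' ↔ a = a' ∧ b = b' := by
  constructor
  · intro h
    simp only [framePt] at h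
    exact eq_of_frame_eq (by rwa [add_assoc, add_assoc, add_left_cancel_iff] at h)
  · rintro ⟨rfl, rfl⟩; rfl

/-- Quarter turn of the frame: `e_{k+1}, e_{k+2} = e_{k+1}, -e_k`. [folklore] -/
theorem framePt_rot_one (x : Site 2) (k : Fin 4) (a b : ℝ) :
    framePt δ (x, k + 1) a b = framePt δ (x, k) (-b) a := by
  simp only [framePt, fin4_add_one_add_one, meshPoint_dir_add_two, meshPoint_neg_scale]
  abel

/-- Half turn of the frame. [folklore] -/
theorem framePt_rot_two (x : Site 2) (k : Fin 4) (a b : ℝ) :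
    framePt δ (x, k + 2) a b = framePt δ (x, k) (-a) (-b) := by
  simp only [framePt, fin4_add_two_add_one, meshPoint_dir_add_two, meshPoint_dir_add_three, meshPoint_neg_scale]

/-- Three-quarter turn of the frame. [folklore] -/
theorem framePt_rot_three (x : Site 2) (k : Fin 4) (a b : ℝ) :
    framePt δ (x, k + 3) a b = framePt δ (x, k) b (-a) := by
  simp only [framePt, fin4_add_three_add_one, meshPoint_dir_add_three, meshPoint_neg_scale]
  abel

/-- Every direction is one of `k, k+1, k+2, k+3`. [folklore] -/
theorem fin4_cases_add (K k : Fin 4) : K = k ∨ K = k + 1 ∨ K = k + 2 ∨ K = k + 3 := by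
  revert K k; decide

/-- **A frame point at `x` in any frame, read in the frame `k`.** [folklore] -/
theorem framePt_eq_frame (x : Site 2) (K k : Fin 4) (a b : ℝ) :
    (K = k ∧ framePt δ (x, K) a b = framePt δ (x, k) a b) ∨
    (K = k + 1 ∧ framePt δ (x, K) a b = framePt δ (x, k) (-b) a) ∨
    (K = k + 2 ∧ framePt δ (x, K) a b = framePt δ (x, k) (-a) (-b)) ∨
    (K = k + 3 ∧ framePt δ (x, K) a b = framePt δ (x, k) b (-a)) := by
  rcases fin4_cases_add K k with rfl | rfl | rfl | rfl
  · exact Or.inl ⟨rfl, rfl⟩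
  · exact Or.inr (Or.inl ⟨rfl, framePt_rot_one x k a b⟩)
  · exact Or.inr (Or.inr (Or.inl ⟨rfl, framePt_rot_two x k a b⟩))
  · exact Or.inr (Or.inr (Or.inr ⟨rfl, framePt_rot_three x k a b⟩))

/-- **Reversal of an arrow**: the frame point `(t, σ)` of `(v, K)` is the frame point `(δ - t, -σ)` of the
reversed arrow `(v + e_K, K + 2)`. [folklore] -/
theorem framePt_reverse (v : Site 2) (K : Fin 4) (t σ : ℝ) :
    framePt δ (v, K) t σ = framePt δ (v + dir K, K + 2) (δ - t) (-σ) := by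
  simp only [framePt, fin4_add_two_add_one, meshPoint_dir_add_two, meshPoint_dir_add_three, meshPoint_neg_scale,
    meshPoint_add_dir, sub_eq_add_neg, meshPoint_add_scale]
  abel

/-- The reversed arrow has the same edge. [folklore] -/
theorem aedge_reverse (v : Site 2) (K : Fin 4) : aedge (v + dir K, K + 2) = aedge (v, K) := by
  simp only [aedge, dir_add_two, ← sub_eq_add_neg, add_sub_cancel_right]
  exact Sym2.eq_swap

/-- Coordinates of a frame point relative to its lattice point. [folklore] -/
theorem framePt_sub_coords (x : Site 2) (k : Fin 4) (a b : ℝ) :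
    (framePt δ (x, k) a b).re - δ * x 0 = a * dir k 0 - b * dir k 1 ∧
      (framePt δ (x, k) a b).im - δ * x 1 = a * dir k 1 + b * dir k 0 := by
  simp only [framePt_re, framePt_im, dir_succ_apply_zero, dir_succ_apply_one, Int.cast_neg]
  constructor <;> ring

/-- The sup-distance of a frame point from its lattice point is at most `|a| + |b|` in each coordinate,
and one coordinate offset is `±a` or `±b`: precisely, the pair of offsets is `(a, b)` up to the symmetries of
the square. [folklore] -/
theorem framePt_offsets (x : Site 2) (k : Fin 4) (a b : ℝ) :
    ((framePt δ (x, k) a b).re - δ * x 0 = a ∧ (framePt δ (x, k) a b).im - δ * x 1 = b) ∨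
    ((framePt δ (x, k) a b).re - δ * x 0 = -b ∧ (framePt δ (x, k) a b).im - δ * x 1 = a) ∨
    ((framePt δ (x, k) a b).re - δ * x 0 = -a ∧ (framePt δ (x, k) a b).im - δ * x 1 = -b) ∨
    ((framePt δ (x, k) a b).re - δ * x 0 = b ∧ (framePt δ (x, k) a b).im - δ * x 1 = -a) := by
  obtain ⟨hre, him⟩ := framePt_sub_coords (δ := δ) x k a b
  rcases dir_apply_cases k with ⟨h0, h1⟩ | ⟨h0, h1⟩ | ⟨h0, h1⟩ | ⟨h0, h1⟩ <;>
    simp only [h0, h1, Int.cast_one, Int.cast_zero, Int.cast_neg] at hre him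
  · exact Or.inl ⟨by linarith, by linarith⟩
  · exact Or.inr (Or.inl ⟨by linarith, by linarith⟩)
  · exact Or.inr (Or.inr (Or.inl ⟨by linarith, by linarith⟩))
  · exact Or.inr (Or.inr (Or.inr ⟨by linarith, by linarith⟩))

/-! ### Localisation of side and connector points near a lattice point -/

/-- **Integer frame coordinates**: every lattice vector is an integer combination of `e_K, e_{K+1}`.
[folklore] -/
theorem site_eq_frame (y : Site 2) (K : Fin 4) :
    y = (y 0 * dir K 0 + y 1 * dir K 1) • dir K + (y 0 * dir (K + 1) 0 + y 1 * dir (K + 1) 1) • dir (K + 1) := by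
  have e0 := dir_succ_apply_zero K
  have e1 := dir_succ_apply_one K
  rcases dir_apply_cases K with ⟨h0, h1⟩ | ⟨h0, h1⟩ | ⟨h0, h1⟩ | ⟨h0, h1⟩ <;>
    rw [h0] at e1 <;> rw [h1] at e0 <;> ext i <;> fin_cases i <;>
    simp [Pi.add_apply, h0, h1, e0, e1]

/-- Moving the base point of a frame by an integer frame vector shifts the frame coordinates. [folklore] -/
theorem framePt_base_add (v : Site 2) (K : Fin 4) (n n' : ℤ) (a b : ℝ) :
    framePt δ (v + n • dir K + n' • dir (K + 1), K) a b = framePt δ (v, K) (a + δ * n) (b + δ * n') := by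
  simp only [framePt]
  apply Complex.ext <;>
    simp [meshPoint, Site.toComplex, Pi.add_apply] <;> ring

/-- A frame point based at `v`, read in the parallel frame at another lattice point `x`. [folklore] -/
theorem exists_framePt_rebase (v x : Site 2) (K : Fin 4) (a b : ℝ) :
    ∃ n n' : ℤ, x = v + n • dir K + n' • dir (K + 1) ∧
      framePt δ (v, K) a b = framePt δ (x, K) (a - δ * n) (b - δ * n') := by
  obtain ⟨n, n', hy⟩ : ∃ n n' : ℤ, x - v = n • dir K + n' • dir (K + 1) := ⟨_, _, site_eq_frame (x - v) K⟩
  refine ⟨n, n', by rw [add_assoc, ← hy]; abel, ?_⟩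
  have hx : x = v + n • dir K + n' • dir (K + 1) := by rw [add_assoc, ← hy]; abel
  rw [hx, framePt_base_add]
  congr 1 <;> ring

/-- Both frame coordinates of a frame point sup-close to its base point are small. [folklore] -/
theorem abs_lt_of_framePt_near {x : Site 2} {k : Fin 4} {a b m : ℝ}
    (hre : |(framePt δ (x, k) a b).re - δ * x 0| < m) (him : |(framePt δ (x, k) a b).im - δ * x 1| < m) :
    |a| < m ∧ |b| < m := by
  rcases framePt_offsets (δ := δ) x k a b with ⟨h0, h1⟩ | ⟨h0, h1⟩ | ⟨h0, h1⟩ | ⟨h0, h1⟩ <;>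
    rw [h0] at hre <;> rw [h1] at him
  · exact ⟨hre, him⟩
  · exact ⟨him, by rwa [abs_neg] at hre⟩
  · exact ⟨by rwa [abs_neg] at hre, by rwa [abs_neg] at him⟩
  · exact ⟨by rwa [abs_neg] at him, hre⟩

/-- **Localisation of side points.** A point of the side of the dart `(v, K)` whose coordinate offsets
from the lattice point `δx` are `< δ - η` in absolute value is based at `x`: `v = x`, and it is
`framePt δ (x, K) η s` with `|s| ≤ η`. [folklore] -/
theorem side_near (hδ : 0 < δ) (hη : 0 < η) {x v : Site 2} {K : Fin 4} {z : ℂ}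
    (hz : z ∈ segment ℝ (framePt δ (v, K) η (-η)) (framePt δ (v, K) η η))
    (hre : |z.re - δ * x 0| < δ - η) (him : |z.im - δ * x 1| < δ - η) :
    v = x ∧ ∃ s, |s| ≤ η ∧ z = framePt δ (x, K) η s := by
  obtain ⟨s, ⟨hs0, hs1⟩, rfl⟩ := exists_of_mem_segment_snd (by linarith) hz
  obtain ⟨n, n', hx, heq⟩ := exists_framePt_rebase (δ := δ) v x K η s
  rw [heq] at hre him
  obtain ⟨ha, hb⟩ := abs_lt_of_framePt_near hre him
  have hn : n = 0 := int_eq_zero_of_near hδ (by rw [abs_of_pos hη]) ha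
  have hn' : n' = 0 := int_eq_zero_of_near hδ (abs_le.2 ⟨hs0, hs1⟩) hb
  subst hn hn'
  simp only [zero_smul, add_zero] at hx
  refine ⟨hx.symm, s, abs_le.2 ⟨hs0, hs1⟩, ?_⟩
  rw [heq]; simp

/-- **Localisation of connector points.** A connector point `framePt δ a t (±η)` (`aedge a ∈ E`,
`η ≤ t ≤ δ - η`) whose coordinate offsets from `δx` are `< δ - η` lies alongside an edge of `E` AT `x`: it is
`framePt δ (x, K) t' (±η)` with `aedge (x, K) ∈ E`, `η ≤ t' ≤ δ - η`. [folklore] -/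
theorem conn_near (hδ : 0 < δ) (hη : 0 < η) {x : Site 2} {a : Site 2 × Fin 4} {t : ℝ} {z : ℂ}
    (ha : aedge a ∈ E) (ht : t ∈ Icc η (δ - η)) (hz : z = framePt δ a t η ∨ z = framePt δ a t (-η))
    (hre : |z.re - δ * x 0| < δ - η) (him : |z.im - δ * x 1| < δ - η) :
    ∃ (K : Fin 4) (t' : ℝ), t' ∈ Icc η (δ - η) ∧ aedge (x, K) ∈ E ∧
      (z = framePt δ (x, K) t' η ∨ z = framePt δ (x, K) t' (-η)) := by
  obtain ⟨v, K⟩ := a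
  -- `z = framePt δ (v, K) t σ` with `|σ| = η`
  obtain ⟨σ, hσ, rfl⟩ : ∃ σ : ℝ, |σ| = η ∧ z = framePt δ (v, K) t σ := by
    rcases hz with rfl | rfl
    · exact ⟨η, abs_of_pos hη, rfl⟩
    · exact ⟨-η, by rw [abs_neg, abs_of_pos hη], rfl⟩
  obtain ⟨n, n', hx, heq⟩ := exists_framePt_rebase (δ := δ) v x K t σ
  rw [heq] at hre him
  obtain ⟨ha', hb'⟩ := abs_lt_of_framePt_near hre him
  have hn' : n' = 0 := int_eq_zero_of_near hδ hσ.le hb'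
  subst hn'
  simp only [zero_smul, add_zero] at hx
  rcases int_eq_zero_or_one_of_near hδ hη ht ha' with rfl | rfl
  · simp only [zero_smul, add_zero] at hx
    subst hx
    refine ⟨K, t, ht, ha, ?_⟩
    rcases hz with h | h
    · exact Or.inl h
    · exact Or.inr h
  · simp only [one_smul] at hx
    subst hx
    refine ⟨K + 2, δ - t, ⟨by linarith [ht.2], by linarith [ht.1]⟩, by rw [aedge_reverse]; exact ha, ?_⟩
    rcases hz with h | h
    · right; rw [h, framePt_reverse]
    · left; rw [h, framePt_reverse, neg_neg]

end WindowRect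

/-- **Localisation of side points**, closed form (registered sub-goal of stmt-CriticalPhenomena-10650).
[folklore] -/
theorem windowRect_side_near : ∀ {δ η : ℝ}, 0 < δ → 0 < η → ∀ {x v : Site 2} {K : Fin 4} {z : ℂ}, z ∈ segment ℝ (WindowRect.framePt δ (v, K) η (-η)) (WindowRect.framePt δ (v, K) η η) → |z.re - δ * x 0| < δ - η → |z.im - δ * x 1| < δ - η → v = x ∧ ∃ s, |s| ≤ η ∧ z = WindowRect.framePt δ (x, K) η s :=
  fun hδ hη _ _ _ _ hz hre him => WindowRect.side_near hδ hη hz hre him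

end Summit.CriticalPhenomena.SAWScalingLimit.Theorems.IsingBoundaryRatio

end
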